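import Summits.ValiantsHypothesis.ValiantsHypothesis.Theorems.BarrierLeverPartitionMinorsSubsetSumVandermonde

/-!
# Route BarrierLever — item `PartitionMinorsHitByVP` (stmt-ValiantsHypothesis-19717):
# the subset-sum multilinear Vandermonde is nonsingular for EVERY row family (Frobenius / reduction mod 2)

Helper file (`--supports stmt-ValiantsHypothesis-19717`; cell valiant-natproofs, rung V4, 𝒟-side door (c),
prover seat val-np-p1, gen 10). Closes NO item; definition-free; pure algebra, no circuits.

**Theorem (`SubsetSum.det_ssv_ne_zero_of_injective`, ENGINE v3).** For every `κ, h` and every INJECTIVE row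
family `u : (Fin κ → Bool) → Finset (Fin h)` the symbolic subset-sum Vandermonde
`ssv κ u = [∏_{c : W c} (X_(c,none) + Σ_{k ∈ u i} X_(c, some k))]_{i, W}` (file `…SubsetSumVandermonde`) has
`det ≠ 0` over `ℂ`. No halving hypothesis, no certificate: this settles the «generic-nonsingularity
conjecture» of the cell's owner table (all `2^κ` distinct rows × `κ`-face columns); recursive halving
(`IsSplittable`, engine v1 `det_ssv_ne_zero`) was a strictly weaker sufficient condition (`CubeHalving 7 6` is
false, val-np-p3 g4, while the determinant survives — now explained).

*Proof (reduction mod 2).* The matrix has an integer model (`MvPolynomial.map ℤ → ℂ` of it is `ssv`, and `map`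
along an injective ring map is injective), so it suffices that the integer determinant is nonzero, and for that
it suffices to exhibit ONE ring map under which it is nonzero. Evaluate in `𝔽₂[t]` at the FROBENIUS TABLE
`X_(c,none) ↦ 0`, `X_(c,some k) ↦ t^(k·2^c)`: Frobenius being additive in characteristic 2,
`Σ_{k∈U} t^(k·2^c) = (Σ_{k∈U} t^k)^(2^c) = ξ_U^(2^c)` with the CODE POLYNOMIAL `ξ_U := Σ_{k∈U} t^k` (injective
in `U`: its coefficients are the indicator of `U`), so the entry `(i, W)` becomes `ξ_{u i}^(bin W)` with
`bin W = Σ_{c : W c} 2^c`, and `bin : (Fin κ → Bool) ≃ Fin (2^κ)` (Mathlib's `finFunctionFinEquiv`). The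
evaluated matrix IS the Vandermonde matrix of the `2^κ` distinct polynomials `ξ_{u i}`, nonsingular in the
domain `𝔽₂[t]` (`Matrix.det_vandermonde_ne_zero_iff`).

**Corollary (`SubsetSum.exists_det_ne_zero_of_injective`).** Numeric tables `Γ₀, Γ` over `ℂ` with
`det [∏_{c : W c} (Γ₀ c + Σ_{k∈u i} Γ k c)]_{i,W} ≠ 0` exist for every injective `u` — literally the hypothesis
of the additive door `AdditiveDoor.partitionMinor_hit_of_additive_mem`; the class theorem «ALL rows × FACE
columns» (and its mirror) is assembled in `…PartitionMinorsHitByVPAllRowsFaces`.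

WHAT THIS IS NOT: the trick needs the column exponents `bin W` to exhaust `{0,…,2^κ−1}` (a full face); for other
column families the evaluated matrix is a generalized Vandermonde whose Schur factor can vanish mod 2, so nothing
is claimed there; nothing on CPM (items 20172/20195), crux 14610 or VP vs VNP.
-/

set_option linter.dupNamespace false

namespace Summit.ValiantsHypothesis.ValiantsHypothesis.Theorems.BarrierLever.SubsetSum

open Finset MvPolynomial Matrix

noncomputable section

variable {h : ℕ}

/-! ## 1. The code polynomial `ξ_U = Σ_{k∈U} t^k ∈ 𝔽₂[t]` -/

/-- The coefficients of the code polynomial `Σ_{k∈U} t^k` are the indicator of `U`. -/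
theorem coeff_codePoly (U : Finset (Fin h)) (k : Fin h) :
    (∑ j ∈ U, (Polynomial.X : Polynomial (ZMod 2)) ^ (j : ℕ)).coeff (k : ℕ) =
      if k ∈ U then 1 else 0 := by
  rw [Polynomial.finsetSum_coeff]
  simp_rw [Polynomial.coeff_X_pow, Fin.val_inj]
  exact Finset.sum_ite_eq U k fun _ => 1

/-- The code polynomial is injective in `U`. -/
theorem codePoly_injective :
    Function.Injective fun U : Finset (Fin h) => ∑ j ∈ U, (Polynomial.X : Polynomial (ZMod 2)) ^ (j : ℕ) := by
  intro U V hUV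
  ext k
  have := congrArg (fun q => Polynomial.coeff q (k : ℕ)) hUV
  simp only [coeff_codePoly] at this
  by_cases hU : k ∈ U <;> by_cases hV : k ∈ V <;> simp_all

/-! ## 2. The Frobenius evaluation -/

/-- **Frobenius additivity.** Under `X_(c,none) ↦ 0`, `X_(c,some k) ↦ t^(k·2^c)` the symbolic coordinate
`lin κ c U` (integer model) becomes `ξ_U^(2^c)`. -/
theorem frob_lin (κ : ℕ) (c : Fin κ) (U : Finset (Fin h)) :
    eval₂Hom (Int.castRingHom (Polynomial (ZMod 2)))
        (fun p : Fin κ × Option (Fin h) =>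
          Option.elim p.2 0 fun k => (Polynomial.X : Polynomial (ZMod 2)) ^ ((k : ℕ) * 2 ^ (p.1 : ℕ)))
        (X (c, none) + ∑ k ∈ U, X (c, some k) : MvPolynomial (Fin κ × Option (Fin h)) ℤ) =
      (∑ j ∈ U, (Polynomial.X : Polynomial (ZMod 2)) ^ (j : ℕ)) ^ 2 ^ (c : ℕ) := by
  simp only [map_add, map_sum, coe_eval₂Hom, eval₂_X, Option.elim, zero_add]
  rw [sum_pow_char_pow 2 (c : ℕ) U]
  refine Finset.sum_congr rfl fun k _ => ?_
  rw [← pow_mul]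

/-- The evaluated entry `(i, W)` of the integer model is `ξ_{u i}^(bin W)`, `bin W = Σ_{c : W c} 2^c`. -/
theorem frob_entry (κ : ℕ) (u : (Fin κ → Bool) → Finset (Fin h)) (i W : Fin κ → Bool) :
    eval₂Hom (Int.castRingHom (Polynomial (ZMod 2)))
        (fun p : Fin κ × Option (Fin h) =>
          Option.elim p.2 0 fun k => (Polynomial.X : Polynomial (ZMod 2)) ^ ((k : ℕ) * 2 ^ (p.1 : ℕ)))
        (∏ c : Fin κ, if W c then (X (c, none) + ∑ k ∈ u i, X (c, some k)) else 1 :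
          MvPolynomial (Fin κ × Option (Fin h)) ℤ) =
      (∑ j ∈ u i, (Polynomial.X : Polynomial (ZMod 2)) ^ (j : ℕ)) ^
        (∑ c : Fin κ, if W c then 2 ^ (c : ℕ) else 0) := by
  rw [map_prod, ← Finset.prod_pow_eq_pow_sum]
  refine Finset.prod_congr rfl fun c _ => ?_
  split_ifs
  · exact frob_lin κ c (u i)
  · simp

/-- The binary value of a bit-vector as computed by Mathlib's `finFunctionFinEquiv` (after `Bool ≃ Fin 2`). -/
theorem binEquiv_val (κ : ℕ) (W : Fin κ → Bool) :
    ((((Equiv.refl (Fin κ)).arrowCongr finTwoEquiv.symm).trans finFunctionFinEquiv W : Fin (2 ^ κ)) : ℕ) =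
      ∑ c : Fin κ, if W c then 2 ^ (c : ℕ) else 0 := by
  rw [Equiv.trans_apply, finFunctionFinEquiv_apply]
  refine sum_congr rfl fun c _ => ?_
  show ((finTwoEquiv.symm (W ((Equiv.refl (Fin κ)).symm c)) : Fin 2) : ℕ) * 2 ^ (c : ℕ) = _
  rw [Equiv.refl_symm, Equiv.refl_apply]
  cases W c
  · show ((0 : Fin 2) : ℕ) * 2 ^ (c : ℕ) = if false = true then 2 ^ (c : ℕ) else 0
    simp
  · show ((1 : Fin 2) : ℕ) * 2 ^ (c : ℕ) = if true = true then 2 ^ (c : ℕ) else 0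
    simp

/-- **The integer model has nonzero determinant**: its Frobenius evaluation is a reindexed Vandermonde
matrix of the distinct code polynomials `ξ_{u i}`. -/
theorem det_ssvZ_ne_zero (κ : ℕ) (u : (Fin κ → Bool) → Finset (Fin h)) (hu : Function.Injective u) :
    (Matrix.of fun i W : Fin κ → Bool =>
      (∏ c : Fin κ, if W c then (X (c, none) + ∑ k ∈ u i, X (c, some k)) else 1 :
        MvPolynomial (Fin κ × Option (Fin h)) ℤ)).det ≠ 0 := by
  -- the Frobenius evaluation, the binary-value bijection, the code polynomials
  let ψ : MvPolynomial (Fin κ × Option (Fin h)) ℤ →+* Polynomial (ZMod 2) :=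
    eval₂Hom (Int.castRingHom (Polynomial (ZMod 2)))
      (fun p : Fin κ × Option (Fin h) =>
        Option.elim p.2 0 fun k => (Polynomial.X : Polynomial (ZMod 2)) ^ ((k : ℕ) * 2 ^ (p.1 : ℕ)))
  let e : (Fin κ → Bool) ≃ Fin (2 ^ κ) :=
    ((Equiv.refl (Fin κ)).arrowCongr finTwoEquiv.symm).trans finFunctionFinEquiv
  let ξ : Finset (Fin h) → Polynomial (ZMod 2) := fun U =>
    ∑ j ∈ U, (Polynomial.X : Polynomial (ZMod 2)) ^ (j : ℕ)
  -- the evaluated matrix is the reindexed Vandermonde matrix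
  have hmat : ψ.mapMatrix (Matrix.of fun i W : Fin κ → Bool =>
      (∏ c : Fin κ, if W c then (X (c, none) + ∑ k ∈ u i, X (c, some k)) else 1 :
        MvPolynomial (Fin κ × Option (Fin h)) ℤ)) =
      (Matrix.vandermonde fun j : Fin (2 ^ κ) => ξ (u (e.symm j))).submatrix e e := by
    refine Matrix.ext fun i W => ?_
    rw [RingHom.mapMatrix_apply, Matrix.map_apply, Matrix.of_apply, Matrix.submatrix_apply,
      Matrix.vandermonde_apply, Equiv.symm_apply_apply]
    show _ = (∑ j ∈ u i, (Polynomial.X : Polynomial (ZMod 2)) ^ (j : ℕ)) ^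
      (((((Equiv.refl (Fin κ)).arrowCongr finTwoEquiv.symm).trans finFunctionFinEquiv W :
        Fin (2 ^ κ)) : ℕ))
    rw [binEquiv_val]
    exact frob_entry κ u i W
  -- whose determinant is nonzero
  have hdet : (ψ.mapMatrix (Matrix.of fun i W : Fin κ → Bool =>
      (∏ c : Fin κ, if W c then (X (c, none) + ∑ k ∈ u i, X (c, some k)) else 1 :
        MvPolynomial (Fin κ × Option (Fin h)) ℤ))).det ≠ 0 := by
    rw [hmat, Matrix.det_submatrix_equiv_self, Matrix.det_vandermonde_ne_zero_iff]
    exact codePoly_injective.comp (hu.comp e.symm.injective)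
  -- pull back along `ψ`
  intro h0
  apply hdet
  rw [← RingHom.map_det, h0, map_zero]

/-! ## 3. Engine v3 -/

/-- **ENGINE v3.** The symbolic subset-sum Vandermonde `ssv κ u` of EVERY injective row family `u` is
nonsingular (no splittability hypothesis; compare engine v1 `det_ssv_ne_zero`). -/
theorem det_ssv_ne_zero_of_injective (κ : ℕ) (u : (Fin κ → Bool) → Finset (Fin h))
    (hu : Function.Injective u) : (ssv κ u).det ≠ 0 := by
  -- `ssv` is the image of the integer model under `map ℤ → ℂ`
  have hmap : MvPolynomial.map (Int.castRingHom ℂ) (Matrix.of fun i W : Fin κ → Bool =>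
      (∏ c : Fin κ, if W c then (X (c, none) + ∑ k ∈ u i, X (c, some k)) else 1 :
        MvPolynomial (Fin κ × Option (Fin h)) ℤ)).det = (ssv κ u).det := by
    rw [RingHom.map_det]
    congr 1
    refine Matrix.ext fun i W => ?_
    rw [RingHom.mapMatrix_apply, Matrix.map_apply, Matrix.of_apply, map_prod]
    refine Finset.prod_congr rfl fun c _ => ?_
    split_ifs
    · simp [lin, map_X]
    · exact map_one _
  intro h0
  apply det_ssvZ_ne_zero κ u hu
  apply MvPolynomial.map_injective (Int.castRingHom ℂ) Int.cast_injective
  rw [hmap, h0, map_zero]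

/-! ## 4. Numeric corollary -/

/-- **Numeric subset-sum Vandermonde, ALL row families.** For every injective `u` there are numbers `Γ₀, Γ`
making the multilinear Vandermonde at the subset-sum points nonsingular (columns = all `2^κ` bit-vectors) —
the hypothesis of the additive door. -/
theorem exists_det_ne_zero_of_injective (κ : ℕ) (u : (Fin κ → Bool) → Finset (Fin h))
    (hu : Function.Injective u) :
    ∃ (Γ₀ : Fin κ → ℂ) (Γ : Fin h → Fin κ → ℂ),
      (Matrix.of fun i W : Fin κ → Bool =>
        ∏ c : Fin κ, if W c then (Γ₀ c + ∑ k ∈ u i, Γ k c) else (1 : ℂ)).det ≠ 0 := by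
  have hne := det_ssv_ne_zero_of_injective κ u hu
  have : ∃ x : Fin κ × Option (Fin h) → ℂ, eval x (ssv κ u).det ≠ 0 := by
    by_contra hcon
    push Not at hcon
    exact hne (MvPolynomial.funext fun x => by rw [hcon x, map_zero])
  obtain ⟨x, hx⟩ := this
  refine ⟨fun c => x (c, none), fun k c => x (c, some k), ?_⟩
  rw [RingHom.map_det] at hx
  convert hx using 2
  ext i W
  simp only [Matrix.of_apply, RingHom.mapMatrix_apply, Matrix.map_apply, ssv, map_prod]
  refine Finset.prod_congr rfl fun c _ => ?_
  split_ifs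
  · simp [lin, map_add, map_sum, eval_X]
  · simp

end

end Summit.ValiantsHypothesis.ValiantsHypothesis.Theorems.BarrierLever.SubsetSum
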